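import Summits.Ventures.HodgeRepro2.T7SupportRegularStabilizer

/-!
# Regularity of the local representative from the GLOBAL regularity of `γ₀` (support, seat p1)

Row 721 (`T7SupportRegularStabilizer`) reduces x1's `hmatch` to `Regular P (loc γ₀)` + (C) on the centre, with
`regular_of_kappa` bridging `Regular` to row 662's `kappa σ d f γ ∉ {0, 1}` OVER THE SAME FIELD. The Line-3 record reads
regularity of the real dominant representative at `v₁` through the GLOBAL adapted pair over the CM field `E`
(`Line3/KappaIsolation` p678820: `map_kappa_ne_zero_iff` / `map_kappa_ne_one_iff`, «regularity is read locally»); the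
local representative is the image of the global matrix under the completion `ψ : E →+* F` (the `[W]` clause
«`loc γ = (matO γ).map ψ` as a unit», t7-L1-p2's row (α) of l. 15829). This file is the TRANSPORT of `Regular` along
any ring homomorphism `ψ : E →+* F` between fields:

* `hasFullColumn_map_iff` — `HasFullColumn (M.map ψ) ↔ HasFullColumn M` (`ψ x ≠ 0 ⟺ x ≠ 0`);
* `regular_map_iff` — for units `γ', P'` over `F` whose matrices are `(γ).map ψ`, `(P).map ψ`:
  `Regular P' γ' ↔ Regular P γ` (`(γ P).map ψ = γ.map ψ · P.map ψ`); `regular_GL_map_iff` — the same for Mathlib's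
  `GeneralLinearGroup.map ψ : GL (Fin 2) E →* GL (Fin 2) F` (the global-to-local map «`loc γ = (matO γ).map ψ` as a
  unit», t7-L1-p2's reading; the two matrix equations hold by `rfl`);
* `col_map` — the columns of `(P).map ψ` are `ψ ∘ f j` when the columns of `P` are `f j` (the second basis of the
  completion is the image of the global one — the `f` of `KappaNatural.kappa_map`);
* **`regular_map_of_kappa`** — GLOBAL regularity ⇒ LOCAL regularity: for an isometry `γ` of the hermitian form over `E`
  with orthogonal data and `kappa σ d f γ ∉ {0, 1}` over `E`, every unit `γ'` over `F` with matrix `(γ).map ψ` is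
  `Regular P'` for every unit `P'` with matrix `(P).map ψ` — so the hypothesis `hreg` of row 721's `hmatch_of_central`
  at the local representative is a THEOREM of the global adapted pair's regularity (the choice of (b′)).

NO κ-TRANSPORT is proved or needed here: the regularity transport suffices (the invariant over `E` is used only over `E`,
through row 721's `regular_of_kappa`; that `κ` over `E` maps to `κ` over `F` is `KappaNatural.kappa_map`, not consumed).
After this row the `[W]` column carries «the global `γ₀` is regular, `κ(γ₀) ∉ {0, 1}` in `E`» (the choice of (b′)) and
the datum sentence «the local second basis `P'` is the image of the global basis `P` under `ψ`» (the two equations) in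
place of «`loc γ₀` is regular». In words (the dictionary, unchanged): `ψ` the completion `E → E_{v₁}`,
`loc γ₀ = (matO γ₀).map ψ`, the global adapted pair `(d, f)` ψ-compatible with the local involution. Nothing here is
about (N), (P), the real `X`, or HC_CM; §8(d): NO.
Blind lane: Mathlib + the HodgeRepro2 prefix; no sorry; axioms ⊆ {propext, Classical.choice, Quot.sound}.
-/

namespace Summit.Ventures.HodgeRepro2.T7SupportRegularTransport

open Matrix Summit.Ventures.HodgeRepro2.T7SupportTwoTorusInvariant
  Summit.Ventures.HodgeRepro2.T7SupportRegularStabilizer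

variable {E F : Type*} [Field E] [Field F] (ψ : E →+* F)

/-- `HasFullColumn` is invariant under `map ψ` (a ring homomorphism between fields is injective). -/
theorem hasFullColumn_map_iff (M : Matrix (Fin 2) (Fin 2) E) : HasFullColumn (M.map ψ) ↔ HasFullColumn M := by
  unfold HasFullColumn
  simp only [Matrix.map_apply, ne_eq, map_eq_zero]

/-- **`Regular` transports along `ψ`**: for units over `F` whose matrices are the images of `γ`, `P`. -/
theorem regular_map_iff {γ P : GL (Fin 2) E} {γ' P' : GL (Fin 2) F}
    (hγ' : (γ' : Matrix (Fin 2) (Fin 2) F) = (γ : Matrix (Fin 2) (Fin 2) E).map ψ)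
    (hP' : (P' : Matrix (Fin 2) (Fin 2) F) = (P : Matrix (Fin 2) (Fin 2) E).map ψ) :
    Regular P' γ' ↔ Regular P γ := by
  unfold Regular
  rw [hγ', hP', ← Matrix.map_mul]
  exact hasFullColumn_map_iff ψ _

/-- **`Regular` for the global-to-local map** `GeneralLinearGroup.map ψ` (the matrix of `GeneralLinearGroup.map ψ γ` is
`(γ).map ψ` by definition). -/
theorem regular_GL_map_iff (γ P : GL (Fin 2) E) :
    Regular (GeneralLinearGroup.map ψ P) (GeneralLinearGroup.map ψ γ) ↔ Regular P γ :=
  regular_map_iff ψ rfl rfl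

/-- the columns of `(P).map ψ` are the images of the columns of `P`. -/
theorem col_map {P : GL (Fin 2) E} {f : Fin 2 → Fin 2 → E} (hP : ∀ j, (P : Matrix (Fin 2) (Fin 2) E).col j = f j)
    {P' : GL (Fin 2) F} (hP' : (P' : Matrix (Fin 2) (Fin 2) F) = (P : Matrix (Fin 2) (Fin 2) E).map ψ) (j : Fin 2) :
    (P' : Matrix (Fin 2) (Fin 2) F).col j = fun i => ψ (f j i) := by
  funext i
  rw [hP', Matrix.col_apply, Matrix.map_apply, ← hP j, Matrix.col_apply]

/-- **GLOBAL regularity ⇒ LOCAL regularity**: an isometry `γ` of the hermitian form over `E` with orthogonal data and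
`κ(γ) ∉ {0, 1}` in `E` has a `Regular` image under every `ψ : E →+* F` — the hypothesis `hreg` of row 721's
`hmatch_of_central` at the local representative. -/
theorem regular_map_of_kappa (σ : E →+* E) (d : Fin 2 → E) (hd : ∀ i, σ (d i) = d i) (hd0 : ∀ i, d i ≠ 0)
    (f : Fin 2 → Fin 2 → E) (hf0 : disc' σ d f 0 ≠ 0) {P γ : GL (Fin 2) E}
    (hP : ∀ j, (P : Matrix (Fin 2) (Fin 2) E).col j = f j)
    (hγ : IsIsom σ d (γ : Matrix (Fin 2) (Fin 2) E))
    (hκ0 : kappa σ d f (γ : Matrix (Fin 2) (Fin 2) E) ≠ 0)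
    (hκ1 : kappa σ d f (γ : Matrix (Fin 2) (Fin 2) E) ≠ 1) {γ' P' : GL (Fin 2) F}
    (hγ' : (γ' : Matrix (Fin 2) (Fin 2) F) = (γ : Matrix (Fin 2) (Fin 2) E).map ψ)
    (hP' : (P' : Matrix (Fin 2) (Fin 2) F) = (P : Matrix (Fin 2) (Fin 2) E).map ψ) : Regular P' γ' :=
  (regular_map_iff ψ hγ' hP').2 (regular_of_kappa σ d hd hd0 f hf0 P γ hP hγ hκ0 hκ1)

/-- the same for the local representative `GeneralLinearGroup.map ψ γ` and the local basis `GeneralLinearGroup.map ψ P`. -/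
theorem regular_GL_map_of_kappa (σ : E →+* E) (d : Fin 2 → E) (hd : ∀ i, σ (d i) = d i) (hd0 : ∀ i, d i ≠ 0)
    (f : Fin 2 → Fin 2 → E) (hf0 : disc' σ d f 0 ≠ 0) {P γ : GL (Fin 2) E}
    (hP : ∀ j, (P : Matrix (Fin 2) (Fin 2) E).col j = f j)
    (hγ : IsIsom σ d (γ : Matrix (Fin 2) (Fin 2) E))
    (hκ0 : kappa σ d f (γ : Matrix (Fin 2) (Fin 2) E) ≠ 0)
    (hκ1 : kappa σ d f (γ : Matrix (Fin 2) (Fin 2) E) ≠ 1) :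
    Regular (GeneralLinearGroup.map ψ P) (GeneralLinearGroup.map ψ γ) :=
  regular_map_of_kappa ψ σ d hd hd0 f hf0 hP hγ hκ0 hκ1 rfl rfl

end Summit.Ventures.HodgeRepro2.T7SupportRegularTransport
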